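import Literature.NumberTheory.GaloisRepresentations.InertiaCohomologyInvariantsBound
import Literature.NumberTheory.GaloisRepresentations.DecompositionGroupOfCompletion
import Literature.NumberTheory.GaloisRepresentations.IntegralGaloisActionProofs
import Literature.NumberTheory.GaloisRepresentations.AbsGaloisOuterConj
import Literature.NumberTheory.GaloisRepresentations.ContinuousCorestriction
import Literature.NumberTheory.EllipticCurves.InertiaInvariantsPrimaryTorsionAdditiveProofs
import Literature.NumberTheory.EllipticCurves.GeomPointsGaloisModule
import Literature.NumberTheory.EllipticCurves.ZpExtensionUnramifiedProofs
import HarnessLib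

/-!
# Route `ThetaPartnerAtTwo` (TP2), crux K2R0P♭ (stmt-BirchSwinnertonDyer-26471; derived node K2r0P 24945), line `rankzero` v19,
# stub `stub_poitouTateDeepTwoGen` = (S_PT) — brick **B6c** of `Cruxes/SignedMainConjectureCMTwoRankZeroOfPub/PT-DEEP-HALF-DESIGN-w2g4.md`
# §2 (d)/§3: **a UNIFORM exponent killing the inertia cohomology `H¹(I_𝔓, E[p^k])`, `H¹(I_𝔓, T_pE)` at
# every ADDITIVE place `v ∤ p` — the integrality defect of the relaxed classes at the bad places, uniform
# in the layer of a `ℤ_p`-tower**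

HONEST FRAMING (cell `pub/bsd-wall`, W-ALL row 1; extra width seat `bsd-wall-tp2-p2-w5` g0, `--supports` only).
THEOREMS ONLY (no definition, no named fact, no instance, no `sorry`); closes no item; BSD is NOT proved by
any of this.  Valid for EVERY elliptic curve over a number field (§1–§2) EVERY prime `p` and EVERY
additive place `v ∤ p`; the sibling file `…PTDeepAdditiveIntegral.lean` rewrites the result over `ℚ` in the
`Kato2004.integralH1` currency (§3) and specialises to CM curves (§4, all bad places additive).

## Why (the memo's §2 (d))

In the (S_PT) route the finite-level classes `x_k ∈ Sel_𝓖(ℚ_n, A[2^k])` produced by Poitou–Tate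
(`SelmerComplement`, brick B4) are RELAXED at the bad places `w ∣ N`; to land in Kato's
`𝐇¹ = lim← H¹(ℤ_n[1/p], T_pA)` (`Kato2004.IwasawaH1Data`, whose levels are `Kato2004.integralH1`:
restriction to `U_n ⊓ I_𝔓` vanishes for EVERY `𝔓 ∤ p`, bad places included) one multiplies by a constant
killing the defect at `w ∣ N`, and this constant must NOT depend on the layer `n` (nor on `k`).  The memo
proposed «`4 · H¹(ℚ_{n,w}, T₂A) = 0` via `#A(ℚ_{n,w})[2^∞] ≤ 4`» (local points, Kodaira–Néron, local
duality).  This file proves an inertia-only replacement: since `ℚ_n/ℚ` is unramified at `w`, `I_𝔓 ≤ U_n`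
for every `n` (`ZpExtension.inertia_le_kerSubgroup`), so the defect lives in the SINGLE group
`H¹(I_𝔓, ·)`, independent of `n`; and at an additive place that group is killed by a constant.

## What is proved

* §1 `exists_natCard_h1_absInertia_torsion_le_of_hasAdditiveReductionAt` — LOCAL UNIFORM BOUND: for
  `E/K`, `v ∤ p` additive, there is `C` with `#H¹(I_{K_v}, E[p^k]) ≤ C` for EVERY `k` and every twist of
  the action by `σ ∈ Γ_K` (action through `θ = σ·res·σ⁻¹`).  Inputs (tree theorems): Serre/Milne
  `#H¹(I_F, B) ≤ #B^{I_F}` for finite `B` of order prime to the residue characteristic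
  (`natCard_continuousCohomology_one_absInertia_le_natCard_invariants`), and the Serre–Tate/Kodaira–Néron
  exponent `c` killing the inertia-fixed `p`-power torsion at an additive place
  (`WeierstrassCurve.exists_nsmul_eq_zero_of_absInertia_fixed_of_hasAdditiveReductionAt`); `C = #E[c]`.
* §2 `exists_nsmul_h1_inertia_torsion_eq_zero_of_hasAdditiveReductionAt` — GLOBAL INERTIA GROUPS: there
  is `e > 0` with `e • H¹(I_𝔓, E[p^k]) = 0` for EVERY prime `𝔓 ∣ v` of `\bar ℤ_K` and every `k`
  (continuous cochains of the subgroup `I_𝔓 ≤ Γ_K`).  Transport: `𝔓 = σ𝔓₀`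
  (`exists_smul_eq_of_mem_primesAbove`), `I_{𝔓₀} = res(I_{K_v})` (`inertia_adicCompletionPrime_eq_map_absInertia`,
  Neukirch II (9.6)), `I_{σ𝔓₀} = σ I_{𝔓₀} σ⁻¹` (`Ideal.conj_mem_inertia_smul_iff`); a cocycle on `I_𝔓` pulls
  back along the surjection `θ : I_{K_v} ↠ I_𝔓`, `C !` kills the pulled-back class (Lagrange), and a
  coboundary witness descends along a surjection.  `e = C !`.
* (sibling file `…PTDeepAdditiveIntegral.lean`, §3, over `ℚ`, the `Kato2004.integralH1` currency `resLe _ (U ⊓ I_𝔓 ≤ U) 1`):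
  `exists_nsmul_resLe_inertia_torsion_eq_zero_of_hasAdditiveReductionAt` (coefficients `E[p^k]`, any
  `U ≥ I_𝔓`), `exists_nsmul_resLe_inertia_tate_eq_zero_of_hasAdditiveReductionAt` (coefficients `T_pE`, by
  `reduceH1Pk_resLe` + separatedness `Kato2004.eq_zero_of_forall_reduceH1Pk_eq_zero`, Rubin B.2.3),
  `exists_nsmul_mem_integralH1_of_forall_not_additive` (ONE exponent `E = ∏_{v additive} e_v` such that
  `E • x ∈ integralH1 (tateRep E p) p U` as soon as `x` is integral at the non-additive `v ≠ p` and `U`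
  contains the inertia groups above the additive ones), and
  `exists_nsmul_mem_integralH1_layerSubgroup_of_forall_not_additive` (the same for `U = κ.layerSubgroup n`,
  EVERY `n`, any `ℤ_p`-extension `κ` — uniform in the layer).
* (sibling, §4) `hasAdditiveReductionAt_of_hasCM_of_not_hasGoodReductionAt` (CM ⇒ every bad place additive, place-indexed)
  and `exists_nsmul_mem_integralH1_layerSubgroup_of_hasCM` — for a CM curve only the GOOD `v ≠ p` remain as
  hypotheses (the unramified condition of the Selmer structure).

What is NOT here: the defect at `v ∋ p` (plus/minus condition, brick B6b), local points, Tamagawa numbers,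
any statement at multiplicative places (there `H¹(I_𝔓, T_pE)` is NOT killed by a constant), (S_PT) itself.
The hypothesis `I_𝔓 ≤ U` of §3 is necessary (over a ramified extension where good reduction is acquired
the uniform bound fails).

References: [SilvermanATAEC1994] Thm. IV.10.2(a) and its proof (PDF pp. 358–359), Thm. II.6.4;
[SerreTate1968] §1 Lemma 2; [MilneADT2006] I §2 Lemma 2.9; [SerreLocalFields1979] IV §2, XIII §1 Prop. 1;
[NeukirchANT1999] II §9 Prop. (9.6); [Rubin2000] App. B Prop. B.2.3; [Kato2004Asterisque] §8.2, Lemma 8.5,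
§12.2; [SerreGaloisCohomology1997] I §2.2–2.4, I §5.1.
-/

set_option autoImplicit false
-- the Theorems namespace of this sub repeats the summit name by design (D-0017 nested layout)
set_option linter.dupNamespace false

noncomputable section

open scoped Classical NumberField Pointwise
open CategoryTheory Function Field ValuativeRel NumberField IsDedekindDomain
  IsDedekindDomain.HeightOneSpectrum
open Literature.NumberTheory.EllipticCurves Literature.NumberTheory.GaloisRepresentations
  Literature.NumberTheory.GaloisRepresentations.IsNonarchimedeanLocalField
open _root_.TopRep _root_.ContinuousCohomology
open WeierstrassCurve (geomPoints geomTorsion)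

namespace Summit.BirchSwinnertonDyer.BirchSwinnertonDyer.Theorems

namespace SignedLowerOffTwo.PTDeep

/-! ## §0 Two elementary facts -/

/-- A finite abelian group of exponent dividing `n`, with `n` prime to `ℓ`, has order prime to `ℓ`
(Cauchy). [folklore] -/
theorem natCard_coprime_of_nsmul_eq_zero {B : Type*} [AddCommGroup B] [Finite B]
    {n ℓ : ℕ} (hℓ : ℓ.Prime) (hn : n.Coprime ℓ) (hB : ∀ b : B, n • b = 0) :
    (Nat.card B).Coprime ℓ := by
  rw [Nat.Coprime, Nat.gcd_comm]
  refine Nat.coprime_of_dvd fun q hq hqℓ hqB => ?_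
  have hq' : q = ℓ := (Nat.prime_dvd_prime_iff_eq hq hℓ).mp hqℓ
  subst hq'
  haveI : Fact q.Prime := ⟨hq⟩
  obtain ⟨b, hb⟩ := exists_prime_addOrderOf_dvd_card' (G := B) q hqB
  have hdvd : q ∣ n := by
    rw [← hb]
    exact addOrderOf_dvd_of_nsmul_eq_zero (hB b)
  have h1 : q ∣ Nat.gcd n q := Nat.dvd_gcd hdvd dvd_rfl
  rw [hn] at h1
  exact hq.one_lt.ne' (Nat.dvd_one.mp h1)

/-- In a finite abelian group of order at most `C`, `C ! • x = 0` (Lagrange: the order kills, and it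
divides `C !`). [folklore] -/
theorem factorial_nsmul_eq_zero_of_natCard_le {B : Type*} [AddCommGroup B] [Finite B] {C : ℕ}
    (hC : Nat.card B ≤ C) (x : B) : C.factorial • x = 0 := by
  obtain ⟨m, hm⟩ := Nat.dvd_factorial (Nat.card_pos (α := B)) hC
  rw [hm, mul_nsmul', card_nsmul_eq_zero']

/-! ## §1 The local uniform bound: `#H¹(I_{K_v}, E[p^k]^{(σ)}) ≤ #E[c]` for every twist `σ` and every `k` -/

variable {K : Type} [Field K] [NumberField K] (W : WeierstrassCurve K) [W.IsElliptic]
  (p : ℕ) [Fact p.Prime] {v : HeightOneSpectrum (𝓞 K)}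

/-- **Uniform local bound at an additive place.**  Let `E/K` be elliptic, `p` a prime, `v ∤ p` a
finite place of ADDITIVE reduction, `K_v` the completion, `res : Γ_{K_v} → Γ_K` the restriction
along the chosen embedding and `I_{K_v} = absInertia K_v`.  There is a constant `C` such that for
EVERY `σ ∈ Γ_K`, EVERY continuous homomorphism `θ : Γ_{K_v} → Γ_K` with `θ(h) = σ·res(h)·σ⁻¹`, and
EVERY level `k`, the group `H¹(I_{K_v}, E[p^k])` (action through `θ`) is finite of order `≤ C`.
Proof: `#H¹(I_F, B) ≤ #B^{I_F}` for a finite discrete module of order prime to the residue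
characteristic (tree: `natCard_continuousCohomology_one_absInertia_le_natCard_invariants`,
Serre *Local Fields* IV §2 / XIII §1, Milne *ADT* I 2.9), and at an additive `v ∤ p` one `c ≠ 0`
kills every inertia-fixed `p`-power torsion point (tree:
`exists_nsmul_eq_zero_of_absInertia_fixed_of_hasAdditiveReductionAt`, Serre–Tate §1 Lemma 2 /
Silverman *ATAEC* IV.10.2(a)), so `B^{I_F} ↪ E[c]` by `b ↦ σ⁻¹ b`; `C = #E[c]`.
[cite: SilvermanATAEC1994, Thm. IV.10.2(a), additive case (PDF pp. 358–359)]
[cite: MilneADT2006, I §2 Lemma 2.9] [cite: SerreLocalFields1979, Ch. IV §2 and Ch. XIII §1 Prop. 1] -/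
theorem exists_natCard_h1_absInertia_torsion_le_of_hasAdditiveReductionAt
    (hpv : (p : 𝓞 K) ∉ v.asIdeal) (hadd : W.HasAdditiveReductionAt v) :
    ∃ C : ℕ, ∀ (σ : absoluteGaloisGroup K)
      (θ : absoluteGaloisGroup (v.adicCompletion K) →ₜ* absoluteGaloisGroup K),
      (∀ h, θ h = σ * absGaloisRestrict K (v.adicCompletion K) h * σ⁻¹) → ∀ k : ℕ,
      Finite (continuousCohomology 1 ((((W.torsionGaloisModule ((p : ℤ) ^ k)).restrict θ).restrict
        (Literature.NumberTheory.GaloisRepresentations.subgroupIncl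
          (absInertia (v.adicCompletion K)))).toTopRep)) ∧
      Nat.card (continuousCohomology 1 ((((W.torsionGaloisModule ((p : ℤ) ^ k)).restrict θ).restrict
        (Literature.NumberTheory.GaloisRepresentations.subgroupIncl
          (absInertia (v.adicCompletion K)))).toTopRep)) ≤ C := by
  have hp : p.Prime := Fact.out
  obtain ⟨c, hc, hkill⟩ :=
    W.exists_nsmul_eq_zero_of_absInertia_fixed_of_hasAdditiveReductionAt p hpv hadd
  haveI hfinc : Finite (geomTorsion W (c : ℤ)) := W.finite_geomTorsion_natCast hc
  refine ⟨Nat.card (geomTorsion W (c : ℤ)), fun σ θ hθ k ↦ ?_⟩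
  -- `E[p^k]` is finite of order prime to the residue characteristic
  haveI hfinB : Finite (geomTorsion W ((p : ℤ) ^ k)) := by
    rw [← Nat.cast_pow]; exact W.finite_geomTorsion_natCast (pow_ne_zero k hp.ne_zero)
  have hprime := ringChar_residueField_prime (F := v.adicCompletion K)
  have hB : (Nat.card (geomTorsion W ((p : ℤ) ^ k))).Coprime (ringChar 𝓀[v.adicCompletion K]) := by
    refine natCard_coprime_of_nsmul_eq_zero (n := p ^ k) hprime ?_ fun b ↦ ?_
    · exact Nat.Coprime.pow_left k ((Nat.coprime_primes hp hprime).mpr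
        (Ne.symm (v.ringChar_residueField_adicCompletion_ne hpv)))
    · apply Subtype.ext
      have hb := (WeierstrassCurve.mem_geomTorsion_iff W ((p : ℤ) ^ k) (b : geomPoints W)).mp b.2
      rw [AddSubmonoidClass.coe_nsmul, ZeroMemClass.coe_zero, ← natCast_zsmul, Nat.cast_pow]
      exact hb
  obtain ⟨hfin, -⟩ := natCard_continuousCohomology_one_absInertia_le (v.adicCompletion K)
    ((W.torsionGaloisModule ((p : ℤ) ^ k)).restrict θ) hB
  refine ⟨hfin, (natCard_continuousCohomology_one_absInertia_le_natCard_invariants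
    (v.adicCompletion K) ((W.torsionGaloisModule ((p : ℤ) ^ k)).restrict θ) hB).trans ?_⟩
  -- the `θ(I_F)`-fixed points inject into `E[c]` by `b ↦ σ⁻¹ • b`
  let f : {b : geomTorsion W ((p : ℤ) ^ k) //
      ∀ τ : absoluteGaloisGroup (v.adicCompletion K), τ ∈ absInertia (v.adicCompletion K) →
        ((W.torsionGaloisModule ((p : ℤ) ^ k)).restrict θ) τ b = b} → geomTorsion W (c : ℤ) :=
    fun b ↦ ⟨σ⁻¹ • ((b : geomTorsion W ((p : ℤ) ^ k)) : geomPoints W), by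
      rw [WeierstrassCurve.mem_geomTorsion_iff, natCast_zsmul]
      refine hkill _ (fun τ hτ ↦ ?_) k ?_
      · have hfix : θ τ • ((b : geomTorsion W ((p : ℤ) ^ k)) : geomPoints W) =
            ((b : geomTorsion W ((p : ℤ) ^ k)) : geomPoints W) :=
          congrArg Subtype.val (b.2 τ hτ)
        rw [hθ τ] at hfix
        rw [smul_smul]
        have h2 : absGaloisRestrict K (v.adicCompletion K) τ * σ⁻¹ =
            σ⁻¹ * (σ * absGaloisRestrict K (v.adicCompletion K) τ * σ⁻¹) := by group
        rw [h2, mul_smul, hfix]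
      · have hb := (WeierstrassCurve.mem_geomTorsion_iff W ((p : ℤ) ^ k) _).mp
          (b : geomTorsion W ((p : ℤ) ^ k)).2
        rw [smul_comm, ← natCast_zsmul, Nat.cast_pow, hb, smul_zero]⟩
  have hf : Function.Injective f := by
    intro a b hab
    have h1 : σ⁻¹ • ((a : geomTorsion W ((p : ℤ) ^ k)) : geomPoints W) =
        σ⁻¹ • ((b : geomTorsion W ((p : ℤ) ^ k)) : geomPoints W) := congrArg Subtype.val hab
    exact Subtype.ext (Subtype.ext (MulAction.injective σ⁻¹ h1))
  exact Nat.card_le_card_of_injective f hf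

/-! ## §2 A uniform exponent killing `H¹(I_𝔓, E[p^k])` for every prime `𝔓 ∣ v` and every `k` -/

/-- **Main local theorem (global inertia groups, torsion coefficients).**  `E/K` elliptic, `p` prime,
`v ∤ p` a finite place of ADDITIVE reduction.  There is `e > 0` such that for EVERY prime `𝔓` of
`\bar ℤ_K` above `v`, every subgroup `I` of `Γ_K` equal to the inertia group `I_𝔓`, and EVERY `k`,
`e` kills the continuous cohomology group `H¹(I, E[p^k])`:  `e • z = 0`.  Proof: `𝔓 = σ • 𝔓₀` for the
prime `𝔓₀` of the chosen embedding (`exists_smul_eq_of_mem_primesAbove`), `I_{𝔓₀} = res(I_{K_v})`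
(`inertia_adicCompletionPrime_eq_map_absInertia`, Neukirch II (9.6)) and `I_{σ𝔓₀} = σ I_{𝔓₀} σ⁻¹`
(`Ideal.conj_mem_inertia_smul_iff`), so `θ = σ·res·σ⁻¹` maps `I_{K_v}` ONTO `I`; a cocycle `ψ` on `I`
pulls back to `I_{K_v}`, where `C !` kills its class (§1), i.e. `C ! • ψ ∘ θ = ∂b`; as `θ` is onto,
`C ! • ψ = ∂b` on `I`.  `e = C !`.
[cite: SilvermanATAEC1994, Thm. IV.10.2(a), additive case (PDF pp. 358–359)]
[cite: NeukirchANT1999, Ch. II §9 Prop. (9.6)] [cite: MilneADT2006, I §2 Lemma 2.9] -/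
theorem exists_nsmul_h1_inertia_torsion_eq_zero_of_hasAdditiveReductionAt
    (hpv : (p : 𝓞 K) ∉ v.asIdeal) (hadd : W.HasAdditiveReductionAt v) :
    ∃ e : ℕ, 0 < e ∧ ∀ 𝔓 ∈ v.primesAbove, ∀ (I : Subgroup (absoluteGaloisGroup K)),
      I = 𝔓.inertia (absoluteGaloisGroup K) → ∀ (k : ℕ)
      (z : continuousCohomology 1 (subgroupRep (W.torsionGaloisModule ((p : ℤ) ^ k)).toTopRep I)),
      e • z = 0 := by
  obtain ⟨C, hC⟩ := exists_natCard_h1_absInertia_torsion_le_of_hasAdditiveReductionAt W p hpv hadd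
  refine ⟨C.factorial, Nat.factorial_pos C, fun 𝔓 h𝔓 I hI k z ↦ ?_⟩
  -- `𝔓 = σ • 𝔓₀`
  obtain ⟨σ, hσ⟩ := HeightOneSpectrum.exists_smul_eq_of_mem_primesAbove_holds
    (adicCompletionPrime_mem_primesAbove K v) h𝔓
  -- `θ = σ · res(·) · σ⁻¹`
  let θ : absoluteGaloisGroup (v.adicCompletion K) →ₜ* absoluteGaloisGroup K :=
    { toFun := fun h ↦ σ * absGaloisRestrict K (v.adicCompletion K) h * σ⁻¹
      map_one' := by simp
      map_mul' := fun a b ↦ by rw [map_mul]; group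
      continuous_toFun := (continuous_const.mul
        (absGaloisRestrict K (v.adicCompletion K)).continuous_toFun).mul continuous_const }
  have hθ : ∀ h, θ h = σ * absGaloisRestrict K (v.adicCompletion K) h * σ⁻¹ := fun _ ↦ rfl
  -- `θ` maps `I_{K_v}` into `I` …
  have hmemI : ∀ h : absInertia (v.adicCompletion K), θ h ∈ I := by
    intro h
    rw [hI, ← hσ, hθ, Ideal.conj_mem_inertia_smul_iff, inertia_adicCompletionPrime_eq_map_absInertia]
    exact Subgroup.mem_map_of_mem _ h.2
  -- … and onto `I`
  have hsurj : ∀ g : I, ∃ h : absInertia (v.adicCompletion K), θ h = g := by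
    intro g
    have hg1 : σ * (σ⁻¹ * (g : absoluteGaloisGroup K) * σ) * σ⁻¹ = g := by group
    have hg : σ⁻¹ * (g : absoluteGaloisGroup K) * σ ∈
        (adicCompletionPrime K v).inertia (absoluteGaloisGroup K) := by
      rw [← Ideal.conj_mem_inertia_smul_iff _ σ, hg1, hσ, ← hI]
      exact g.2
    rw [inertia_adicCompletionPrime_eq_map_absInertia, Subgroup.mem_map] at hg
    obtain ⟨h, hh, hhg⟩ := hg
    refine ⟨⟨h, hh⟩, ?_⟩
    rw [hθ]
    change σ * absGaloisRestrict K (v.adicCompletion K) h * σ⁻¹ = g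
    have hhg' : absGaloisRestrict K (v.adicCompletion K) h = σ⁻¹ * g * σ := hhg
    rw [hhg', hg1]
  obtain ⟨hfin, hcard⟩ := hC σ θ hθ k
  haveI := hfin
  -- the cocycle and its pull-back
  obtain ⟨ψ, rfl⟩ := oneCocycleClass_surjective _ z
  let θ' : absInertia (v.adicCompletion K) → I := fun h ↦ ⟨θ h, hmemI h⟩
  have hθ'c : Continuous θ' :=
    (θ.continuous_toFun.comp continuous_subtype_val).subtype_mk _
  have hθ'mul : ∀ a b, θ' (a * b) = θ' a * θ' b := fun a b ↦
    Subtype.ext (by simp only [θ', Subgroup.coe_mul, map_mul])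
  let Xloc := (((W.torsionGaloisModule ((p : ℤ) ^ k)).restrict θ).restrict
    (Literature.NumberTheory.GaloisRepresentations.subgroupIncl
      (absInertia (v.adicCompletion K)))).toTopRep
  let ψloc : contOneCocycles Xloc :=
    ⟨⟨fun h ↦ ψ.1 (θ' h), ψ.1.continuous.comp hθ'c⟩, fun a b ↦ by
      change ψ.1 (θ' (a * b)) = ψ.1 (θ' a) + Xloc.ρ a (ψ.1 (θ' b))
      rw [hθ'mul, ψ.2]
      rfl⟩
  -- `C !` kills `[ψloc]`: `C ! • ψloc = ∂ b`
  have hkill : oneCocycleClass Xloc (C.factorial • ψloc) = 0 := by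
    rw [← oneCocycleClassₗ_apply, map_nsmul, oneCocycleClassₗ_apply]
    exact factorial_nsmul_eq_zero_of_natCard_le hcard _
  obtain ⟨b, hb⟩ := (oneCocycleClass_eq_zero_iff Xloc _).mp hkill
  -- hence `C ! • ψ = ∂ b` on `I = θ(I_{K_v})`
  rw [← oneCocycleClassₗ_apply, ← map_nsmul, oneCocycleClassₗ_apply, oneCocycleClass_eq_zero_iff]
  refine ⟨b, fun g ↦ ?_⟩
  obtain ⟨h, hh⟩ := hsurj g
  have hg : g = θ' h := Subtype.ext hh.symm
  subst hg
  have h1 := hb h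
  have e1 : ((C.factorial • ψloc : contOneCocycles Xloc) : C(absInertia (v.adicCompletion K), Xloc)) h =
      C.factorial • ψ.1 (θ' h) := by
    rw [Submodule.coe_smul_of_tower]; rfl
  have e2 : ((C.factorial • ψ : contOneCocycles _) :
      C(I, subgroupRep (W.torsionGaloisModule ((p : ℤ) ^ k)).toTopRep I)) (θ' h) =
      C.factorial • ψ.1 (θ' h) := by
    rw [Submodule.coe_smul_of_tower]; rfl
  rw [e2, ← e1, h1]
  rfl

end SignedLowerOffTwo.PTDeep

end Summit.BirchSwinnertonDyer.BirchSwinnertonDyer.Theorems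

end
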